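import Mathlib.NumberTheory.Bertrand
import Literature.Computability.AlgebraicComplexity.BigCwLaserBlocks
import Literature.Computability.AlgebraicComplexity.MultinomialWords
import Literature.Computability.AlgebraicComplexity.WordTypes
import Literature.Computability.AlgebraicComplexity.LaserHashing
import Literature.Computability.AlgebraicComplexity.TensorRestrictionRank
import HarnessLib

/-!
# The level-1 laser method for `CW_q`: the type-restricted support, its fibres, and a large free
diagonal by hashing (CW 1990 §7; BCS 1997 Thm. 15.41 / Cor. 15.45; ADVXXZ 2025 §3.7–3.8) — proved

Topic `Literature/Computability/AlgebraicComplexity`.  Combinatorial half of the second application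
of the laser method theorem (Bürgisser–Clausen–Shokrollahi 1997, Thm. 15.41, proof pp. 381–383, to
`CW_q`, p. 384), companion of `BigCwLaserBlocks.lean` (tensor half) — the `CW_q`-analogue of the
pair `CoppersmithWinograd1990Proofs.lean` §Support / `CwLaserBlocks.lean` for the little tensor.

With the `S₃`-invariant distribution of BCS p. 384 (`P(0,1,1) = P(1,0,1) = P(1,1,0) = (1-β)/3`,
`P(0,0,2) = P(0,2,0) = P(2,0,0) = β/3`) realised exactly by `a` positions of each pattern
`(0,1,1), (1,0,1), (1,1,0)` and `b` positions of each pattern `(0,0,2), (0,2,0), (2,0,0)`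
(`N = 3a + 3b`, `β = b/(a+b)`), every level sequence has the marginal type
`μ = (#0, #1, #2) = (a + 2b, 2a, b)`, and the type-restricted support is
`Φ = {(I, J, L) ∈ ({0,1,2}^N)³ | I_t + J_t + L_t = 2 ∀ t, I, J, L of type μ}`
(BCS p. 381: `Φ = (I_μ × J_ν × L_π) ∩ (supp_D t)^N`).  We prove:

* `laserPatternCounts` — in `Φ` the joint pattern counts are forced by the marginals:
  `#(1,1,·) = #(0,1,·) = #(1,0,·) = a`, `#(0,0,·) = #(0,2,·) = #(2,·,·) = b`;
* `card_filter_fibre_le` — every fibre of the three projections of `Φ` has at most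
  `f = C(2a,a) C(a+2b,a) C(2b,b)` elements (injection into the choices of the pattern classes);
* `le_card_laserSupport` — `|Φ| ≥ binom(N; a,a,a,b,b,b) = binom(N; a+2b, 2a, b) · f`
  (`card_words_eq_multinomial`, `MultinomialWords.lean`);
* `exists_free_bigCw_diagonal` — `Φ` is `2`-tight (`α(I) = I`, `β(J) = J`, `γ(L) = L - 2 ∈ ℤ^N`),
  so the hashing theorem `BCS1997_thm1539_free` (`LaserHashing.lean`, BCS Thm. 15.39) with a
  Bertrand prime `6f < M ≤ 12f` and the Salem–Spencer diagonal (`exists_zeroSum_diagonal`) yields a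
  free diagonal `Δ ⊆ Φ` with `binom(N; a+2b, 2a, b) · rothNumberNat(3f) ≤ 288 f |Δ|`
  (BCS (B): `|Δ| ≥ C min binom(N,μ)`);
* `exists_restrictsTo_bigCw_kroneckerPow` — **`CW_q^{⊗(3a+3b)} ≥ ⟨p⟩ ⊗ ⟨q^a, q^a, q^a⟩`** with
  `binom(N; a+2b, 2a, b) · rothNumberNat(3f) ≤ 288 f p` (with `bigCw_kroneckerPow_blocks`).

One counting definition is introduced (`levelPairCount`; the letter counts `letterCount` are those of `WordTypes.lean`).

## References

* D. Coppersmith, S. Winograd, *Matrix multiplication via arithmetic progressions*, J. Symbolic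
  Comput. 9 (1990) 251–280, §7. [CoppersmithWinograd1990]
* P. Bürgisser, M. Clausen, M. A. Shokrollahi, *Algebraic Complexity Theory* (1997), Thm. 15.39,
  Thm. 15.41 (proof pp. 381–383), p. 384 (the tensor `t^{(q)} ∈ (k^{q+2})^{⊗3}`, Cor. 15.45).
  [BurgisserClausenShokrollahi1997]
* J. Alman, R. Duan, V. Vassilevska Williams, Y. Xu, Z. Xu, R. Zhou, *More asymmetry yields faster
  matrix multiplication*, SODA 2025 = arXiv:2404.16349, §3.7–§3.8 (level-1 blocks and triples of
  `CW_q^{⊗N}`). [AlmanDuanVassilevskaWilliamsXuXuZhou2025]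
-/

noncomputable section

open scoped BigOperators
open Finset

namespace Literature.Computability.AlgebraicComplexity

open Literature.Barriers.MatrixMultiplication (bigCwTensor)

universe u

/-! ## Letter and pattern counts of level sequences -/

section Counts

variable {N : ℕ}

/-- The number of positions at which the pair of level sequences `(P, Q)` takes the value `(x, y)`
(joint pattern counts of a level triple). [cite: BurgisserClausenShokrollahi1997, Thm. 15.41 (proof, p. 381)] -/
def levelPairCount (P Q : Fin N → Fin 3) (x y : Fin 3) : ℕ :=
  (univ.filter fun t => P t = x ∧ Q t = y).card

/-- Unfolding of `levelPairCount`. [folklore] -/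
theorem levelPairCount_def (P Q : Fin N → Fin 3) (x y : Fin 3) :
    levelPairCount P Q x y = (univ.filter fun t => P t = x ∧ Q t = y).card := rfl

/-- A letter count is the sum of the pattern counts over the second letter. [folklore] -/
theorem letterCount_eq_sum_levelPairCount (P Q : Fin N → Fin 3) (x : Fin 3) :
    letterCount P x = ∑ y, levelPairCount P Q x y := by
  rw [letterCount_apply, card_eq_sum_card_fiberwise (f := Q) (t := univ) fun _ _ => mem_univ _]
  refine sum_congr rfl fun y _ => ?_
  rw [levelPairCount, filter_filter]

/-- A letter count of the second sequence is the sum of the pattern counts over the first letter. [folklore] -/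
theorem letterCount_eq_sum_levelPairCount' (P Q : Fin N → Fin 3) (y : Fin 3) :
    letterCount Q y = ∑ x, levelPairCount P Q x y := by
  rw [letterCount_apply, card_eq_sum_card_fiberwise (f := P) (t := univ) fun _ _ => mem_univ _]
  refine sum_congr rfl fun x _ => ?_
  rw [levelPairCount, filter_filter]
  congr 1
  ext t
  simp only [mem_filter, mem_univ, true_and]
  tauto

/-- **The joint pattern counts are forced by the marginal types** (level triples with
`I + J + L ≡ 2` and all three marginals of type `(a+2b, 2a, b)` have exactly `a` positions of each
pattern `(1,1,0), (0,1,1), (1,0,1)` and `b` of each pattern `(0,0,2), (0,2,0), (2,0,0)`; BCS p. 381: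
on `Φ = (I_μ × J_ν × L_π) ∩ (supp_D t)^N` the value of `ζ` is constant).
[cite: BurgisserClausenShokrollahi1997, Thm. 15.41 (proof, p. 381)] -/
theorem laserPatternCounts {a b : ℕ} (P Q R : Fin N → Fin 3)
    (hsum : ∀ t, (P t : ℕ) + Q t + R t = 2)
    (hP0 : letterCount P 0 = a + 2 * b) (hP1 : letterCount P 1 = 2 * a)
    (hQ0 : letterCount Q 0 = a + 2 * b) (hQ1 : letterCount Q 1 = 2 * a) (hQ2 : letterCount Q 2 = b)
    (hR2 : letterCount R 2 = b) :
    levelPairCount P Q 1 1 = a ∧ levelPairCount P Q 0 1 = a ∧ levelPairCount P Q 1 0 = a ∧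
      levelPairCount P Q 0 0 = b ∧ levelPairCount P Q 0 2 = b ∧ levelPairCount P Q 2 0 = b := by
  -- impossible patterns
  have hvan : ∀ x y : Fin 3, 2 < (x : ℕ) + y → levelPairCount P Q x y = 0 := by
    intro x y hxy
    rw [levelPairCount, card_eq_zero, filter_eq_empty_iff]
    rintro t - ⟨rfl, rfl⟩
    have := hsum t
    omega
  have h12 := hvan 1 2 (by decide)
  have h21 := hvan 2 1 (by decide)
  have h22 := hvan 2 2 (by decide)
  -- `R = 2 ↔ (P, Q) = (0, 0)`
  have hR : letterCount R 2 = levelPairCount P Q 0 0 := by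
    rw [letterCount_apply, levelPairCount]
    congr 1
    ext t
    simp only [mem_filter, mem_univ, true_and, Fin.ext_iff, Fin.val_zero, Fin.val_two]
    have := hsum t
    omega
  -- marginal decompositions
  have eP0 := letterCount_eq_sum_levelPairCount P Q 0
  have eP1 := letterCount_eq_sum_levelPairCount P Q 1
  have eQ0 := letterCount_eq_sum_levelPairCount' P Q 0
  have eQ1 := letterCount_eq_sum_levelPairCount' P Q 1
  have eQ2 := letterCount_eq_sum_levelPairCount' P Q 2
  simp only [Fin.sum_univ_three] at eP0 eP1 eQ0 eQ1 eQ2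
  omega

/-- **A level sequence of a supported triple is determined by its partner and three pattern
classes**: if `(P, Q, R)` and `(P, Q', R')` both satisfy `P + Q + R ≡ 2` and have the same classes
`{P=1,Q=1}`, `{P=0,Q=1}`, `{P=0,Q=0}`, then `Q = Q'`. [folklore] -/
theorem eq_of_pattern_classes_eq (P Q R Q' R' : Fin N → Fin 3)
    (hsum : ∀ t, (P t : ℕ) + Q t + R t = 2) (hsum' : ∀ t, (P t : ℕ) + Q' t + R' t = 2)
    (h11 : (univ.filter fun t => P t = 1 ∧ Q t = 1) = univ.filter fun t => P t = 1 ∧ Q' t = 1)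
    (h01 : (univ.filter fun t => P t = 0 ∧ Q t = 1) = univ.filter fun t => P t = 0 ∧ Q' t = 1)
    (h00 : (univ.filter fun t => P t = 0 ∧ Q t = 0) = univ.filter fun t => P t = 0 ∧ Q' t = 0) :
    Q = Q' := by
  funext t
  have e11 := Finset.ext_iff.1 h11 t
  have e01 := Finset.ext_iff.1 h01 t
  have e00 := Finset.ext_iff.1 h00 t
  simp only [mem_filter, mem_univ, true_and, Fin.ext_iff, Fin.val_zero, Fin.val_one] at e11 e01 e00
  have h1 := hsum t
  have h2 := hsum' t
  have hQ := (Q t).2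
  have hQ' := (Q' t).2
  apply Fin.ext
  omega

/-- Given the first two level sequences of a supported triple, the third is determined. [folklore] -/
theorem eq_of_sum_eq (P Q R R' : Fin N → Fin 3)
    (hsum : ∀ t, (P t : ℕ) + Q t + R t = 2) (hsum' : ∀ t, (P t : ℕ) + Q t + R' t = 2) : R = R' := by
  funext t
  have h1 := hsum t
  have h2 := hsum' t
  apply Fin.ext
  omega

end Counts

/-! ## Fibres of the type-restricted support -/

section Fibre

variable {N : ℕ}

/-- The target of the fibre injection over a fixed first sequence `P₀`: an `a`-subset of `{P₀ = 1}`,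
an `a`-subset `B` of `{P₀ = 0}` and a `b`-subset of `{P₀ = 0} ∖ B`; it has
`C(#{P₀=1}, a) · C(#{P₀=0}, a) · C(#{P₀=0} - a, b)` elements. [folklore] -/
theorem card_fibreTarget (P₀ : Fin N → Fin 3) (a b : ℕ) :
    (((univ.filter fun t => P₀ t = 1).powersetCard a) ×ˢ
      (((univ.filter fun t => P₀ t = 0).powersetCard a).sigma fun B =>
        ((univ.filter fun t => P₀ t = 0) \ B).powersetCard b)).card =
      (letterCount P₀ 1).choose a * ((letterCount P₀ 0).choose a * (letterCount P₀ 0 - a).choose b) := by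
  rw [card_product, card_powersetCard, card_sigma, letterCount_apply, letterCount_apply]
  congr 1
  have : ∀ B ∈ (univ.filter fun t => P₀ t = 0).powersetCard a,
      (((univ.filter fun t => P₀ t = 0) \ B).powersetCard b).card =
        ((univ.filter fun t => P₀ t = 0).card - a).choose b := by
    intro B hB
    rw [mem_powersetCard] at hB
    rw [card_powersetCard, card_sdiff_of_subset hB.1, hB.2]
  rw [sum_congr rfl this, sum_const, card_powersetCard, smul_eq_mul]

/-- **Fibres of the type-restricted support over the first coordinate are small**: the supported
triples `(P₀, Q, R)` (`P₀ + Q + R ≡ 2`) having `a` positions of each pattern `(1,1,·), (0,1,·)` and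
`b` of pattern `(0,0,·)` inject into the target of `card_fibreTarget` via their pattern classes
(BCS p. 381: "all its fibres have cardinality `|Φ|/|I_μ|`" — here the upper bound).
[cite: BurgisserClausenShokrollahi1997, Thm. 15.41 (proof, p. 381)] -/
theorem card_filter_fibre_le (P₀ : Fin N → Fin 3) (a b : ℕ)
    (S : Finset ((Fin N → Fin 3) × (Fin N → Fin 3)))
    (hS : ∀ s ∈ S, (∀ t, (P₀ t : ℕ) + s.1 t + s.2 t = 2) ∧
      levelPairCount P₀ s.1 1 1 = a ∧ levelPairCount P₀ s.1 0 1 = a ∧ levelPairCount P₀ s.1 0 0 = b) :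
    S.card ≤ (letterCount P₀ 1).choose a *
      ((letterCount P₀ 0).choose a * (letterCount P₀ 0 - a).choose b) := by
  classical
  rw [← card_fibreTarget P₀ a b]
  refine card_le_card_of_injOn
    (fun s => ((univ.filter fun t => P₀ t = 1 ∧ s.1 t = 1),
      ⟨(univ.filter fun t => P₀ t = 0 ∧ s.1 t = 1), (univ.filter fun t => P₀ t = 0 ∧ s.1 t = 0)⟩))
    (fun s hs => ?_) ?_
  · obtain ⟨hsum, h11, h01, h00⟩ := hS s hs
    rw [levelPairCount] at h11 h01 h00
    simp only [mem_coe, mem_product, mem_powersetCard, mem_sigma]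
    refine ⟨⟨fun t ht => ?_, h11⟩, ⟨fun t ht => ?_, h01⟩, fun t ht => ?_, h00⟩
    · simp only [mem_filter, mem_univ, true_and] at ht ⊢; exact ht.1
    · simp only [mem_filter, mem_univ, true_and] at ht ⊢; exact ht.1
    · simp only [mem_filter, mem_univ, true_and, mem_sdiff, not_and] at ht ⊢
      refine ⟨ht.1, fun _ h => ?_⟩
      rw [ht.2] at h
      exact absurd h (by decide)
  · intro s hs s' hs' h
    simp only [Prod.mk.injEq, Sigma.mk.inj_iff, heq_eq_eq] at h
    obtain ⟨h11, h01, h00⟩ := h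
    obtain ⟨hsum, -⟩ := hS s hs
    obtain ⟨hsum', -⟩ := hS s' hs'
    have hQ : s.1 = s'.1 := eq_of_pattern_classes_eq P₀ s.1 s.2 s'.1 s'.2 hsum hsum' h11 h01 h00
    have hR : s.2 = s'.2 := eq_of_sum_eq P₀ s.1 s.2 s'.2 hsum (hQ ▸ hsum')
    exact Prod.ext hQ hR

end Fibre

/-! ## The type-restricted support `Φ` and its size -/

section SupportDef

variable {N : ℕ}

/-- Letter counts of a projected pattern word: `#{t | g (w t) = x} = ∑_p [g p = x] #{t | w t = p}`. [folklore] -/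
theorem letterCount_comp (g : Fin 6 → Fin 3) (w : Fin N → Fin 6) (x : Fin 3) :
    letterCount (fun t => g (w t)) x = ∑ p, if g p = x then (univ.filter fun t => w t = p).card else 0 := by
  rw [letterCount_apply, card_eq_sum_card_fiberwise (f := w) (t := univ) fun _ _ => mem_univ _]
  refine sum_congr rfl fun p _ => ?_
  by_cases h : g p = x
  · rw [if_pos h, filter_filter]
    congr 1
    ext t
    simp only [mem_filter, mem_univ, true_and, and_iff_right_iff_imp]
    rintro rfl; exact h
  · rw [if_neg h, card_eq_zero, filter_eq_empty_iff]
    rintro t ht rfl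
    exact h (mem_filter.1 ht).2

/-- **The type-restricted support is large**: the pattern words with `a` positions of each pattern
`(0,1,1), (1,0,1), (1,1,0)` and `b` of each pattern `(0,0,2), (0,2,0), (2,0,0)` inject into
`Φ = {(I,J,L) | I+J+L ≡ 2, all of type (a+2b, 2a, b)}`, whence `|Φ| ≥ binom(3a+3b; a,a,a,b,b,b)`
(BCS p. 381: "`Φ` … contains any sequence in `(supp_D t)^N` having the distribution `Q`").
[cite: BurgisserClausenShokrollahi1997, Thm. 15.41 (proof, p. 381)] -/
theorem le_card_laserSupport (a b : ℕ) {N : ℕ} (hN : N = 3 * a + 3 * b)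
    (Φ : Finset ((Fin N → Fin 3) × (Fin N → Fin 3) × (Fin N → Fin 3)))
    (hΦ : ∀ φ : (Fin N → Fin 3) × (Fin N → Fin 3) × (Fin N → Fin 3),
      (∀ t, (φ.1 t : ℕ) + φ.2.1 t + φ.2.2 t = 2) →
      (letterCount φ.1 0 = a + 2 * b ∧ letterCount φ.1 1 = 2 * a ∧ letterCount φ.1 2 = b) →
      (letterCount φ.2.1 0 = a + 2 * b ∧ letterCount φ.2.1 1 = 2 * a ∧ letterCount φ.2.1 2 = b) →
      (letterCount φ.2.2 0 = a + 2 * b ∧ letterCount φ.2.2 1 = 2 * a ∧ letterCount φ.2.2 2 = b) →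
      φ ∈ Φ) :
    Nat.multinomial univ ![a, a, a, b, b, b] ≤ Φ.card := by
  classical
  -- the pattern tables `pI = ![0,1,1,0,0,2]`, `pJ = ![1,0,1,0,2,0]`, `pL = ![1,1,0,2,0,0]`
  have hpat : ∀ p, ((![0, 1, 1, 0, 0, 2] : Fin 6 → Fin 3) p : ℕ) + (![1, 0, 1, 0, 2, 0] : Fin 6 → Fin 3) p + (![1, 1, 0, 2, 0, 0] : Fin 6 → Fin 3) p = 2 := by decide
  have hinj : ∀ p p' : Fin 6, (![0, 1, 1, 0, 0, 2] : Fin 6 → Fin 3) p = (![0, 1, 1, 0, 0, 2] : Fin 6 → Fin 3) p' → (![1, 0, 1, 0, 2, 0] : Fin 6 → Fin 3) p = (![1, 0, 1, 0, 2, 0] : Fin 6 → Fin 3) p' → p = p' := by decide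
  have hk : ∑ p, (![a, a, a, b, b, b] : Fin 6 → ℕ) p = N := by
    simp [Fin.sum_univ_six]; omega
  refine le_of_eq_of_le (card_words_eq_multinomial N ![a, a, a, b, b, b] hk).symm ?_
  refine card_le_card_of_injOn (fun w => (fun t => (![0, 1, 1, 0, 0, 2] : Fin 6 → Fin 3) (w t), fun t => (![1, 0, 1, 0, 2, 0] : Fin 6 → Fin 3) (w t), fun t => (![1, 1, 0, 2, 0, 0] : Fin 6 → Fin 3) (w t)))
    (fun w hw => ?_) ?_
  · simp only [mem_coe, mem_filter, mem_univ, true_and] at hw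
    have hw' := hw
    have hcnt : ∀ (g : Fin 6 → Fin 3) (x : Fin 3), letterCount (fun t => g (w t)) x =
        ∑ p, if g p = x then (![a, a, a, b, b, b] : Fin 6 → ℕ) p else 0 := fun g x => by
      rw [letterCount_comp]
      exact sum_congr rfl fun p _ => by rw [hw' p]
    refine hΦ _ (fun t => hpat (w t)) ⟨?_, ?_, ?_⟩ ⟨?_, ?_, ?_⟩ ⟨?_, ?_, ?_⟩
    all_goals
      rw [hcnt]
      simp only [Fin.sum_univ_six]
      simp
      try omega
  · intro w _ w' _ h
    simp only [Prod.mk.injEq] at h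
    obtain ⟨h1, h2, -⟩ := h
    funext t
    exact hinj _ _ (congrFun h1 t) (congrFun h2 t)

/-- `binom(3a+3b; a,a,a,b,b,b) = binom(3a+3b; a+2b, 2a, b) · C(2a,a) C(a+2b,a) C(2b,b)`
(`|Φ| = |I_μ| · |fibre|`). [folklore] -/
theorem multinomial_six_eq (a b : ℕ) :
    Nat.multinomial univ ![a, a, a, b, b, b] =
      Nat.multinomial univ ![a + 2 * b, 2 * a, b] *
        ((2 * a).choose a * ((a + 2 * b).choose a * (2 * b).choose b)) := by
  have h6 := Nat.multinomial_spec (univ : Finset (Fin 6)) ![a, a, a, b, b, b]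
  have h3 := Nat.multinomial_spec (univ : Finset (Fin 3)) ![a + 2 * b, 2 * a, b]
  simp only [Fin.prod_univ_succ, Fin.prod_univ_zero, Fin.sum_univ_succ, Fin.sum_univ_zero,
    Matrix.cons_val_zero, Matrix.cons_val_succ, mul_one, add_zero] at h6 h3
  have h6' : Nat.multinomial univ ![a, a, a, b, b, b] * (Nat.factorial a ^ 3 * Nat.factorial b ^ 3) =
      Nat.factorial (3 * a + 3 * b) := by
    rw [show 3 * a + 3 * b = a + (a + (a + (b + (b + b)))) by ring, ← h6]; ring
  have h3' : Nat.multinomial univ ![a + 2 * b, 2 * a, b] *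
      (Nat.factorial (a + 2 * b) * Nat.factorial (2 * a) * Nat.factorial b) =
      Nat.factorial (3 * a + 3 * b) := by
    rw [show 3 * a + 3 * b = a + 2 * b + (2 * a + b) by ring, ← h3]; ring
  have hc1 : (2 * a).choose a * Nat.factorial a * Nat.factorial a = Nat.factorial (2 * a) := by
    have := Nat.choose_mul_factorial_mul_factorial (show a ≤ 2 * a by omega)
    rwa [show 2 * a - a = a by omega] at this
  have hc2 : (a + 2 * b).choose a * Nat.factorial a * Nat.factorial (2 * b) =
      Nat.factorial (a + 2 * b) := by
    have := Nat.choose_mul_factorial_mul_factorial (show a ≤ a + 2 * b by omega)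
    rwa [show a + 2 * b - a = 2 * b by omega] at this
  have hc3 : (2 * b).choose b * Nat.factorial b * Nat.factorial b = Nat.factorial (2 * b) := by
    have := Nat.choose_mul_factorial_mul_factorial (show b ≤ 2 * b by omega)
    rwa [show 2 * b - b = b by omega] at this
  set m6 := Nat.multinomial univ ![a, a, a, b, b, b]
  set m3 := Nat.multinomial univ ![a + 2 * b, 2 * a, b]
  have hD : 0 < Nat.factorial a ^ 3 * Nat.factorial b ^ 3 := by positivity
  refine Nat.eq_of_mul_eq_mul_right hD ?_
  have rhs : m3 * ((2 * a).choose a * ((a + 2 * b).choose a * (2 * b).choose b)) *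
      (Nat.factorial a ^ 3 * Nat.factorial b ^ 3) =
      m3 * (((2 * a).choose a * Nat.factorial a * Nat.factorial a) *
        (((a + 2 * b).choose a * Nat.factorial a) * ((2 * b).choose b * Nat.factorial b * Nat.factorial b)) *
          Nat.factorial b) := by ring
  rw [h6', rhs, hc1, hc3, mul_assoc ((a + 2 * b).choose a), ← mul_assoc ((a + 2 * b).choose a), hc2,
    ← h3']
  ring

end SupportDef

/-! ## A large free diagonal by hashing -/

section Hashing

/-- **A large free diagonal of level triples** — the combinatorial half of the level-1 laser method
for `CW_q` (BCS Thm. 15.41, proof, step (B): a diagonal `Δ ⊆ Φ` with `|Δ| ≥ C · min binom(N, μ)`,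
via Thm. 15.39 applied to the `2`-tight set `Φ`): for all `a, b` there is a family `Δ` of level
triples `(I, J, L) ∈ ({0,1,2}^{3a+3b})³` with `I + J + L ≡ 2`, each with `a` positions of each
pattern `(1,1,0), (0,1,1), (1,0,1)`, which is a free diagonal, with
`binom(3a+3b; a+2b, 2a, b) · rothNumberNat(3f) ≤ 288 f |Δ|`, `f = C(2a,a) C(a+2b,a) C(2b,b)`
(hashing theorem with a Bertrand prime `6f < M ≤ 12f` and the Salem–Spencer diagonal of size
`≥ rothNumberNat(M/2)`). [cite: BurgisserClausenShokrollahi1997, Thm. 15.41 (proof, p. 381) and p. 384] -/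
theorem exists_free_bigCw_diagonal (a b : ℕ) :
    ∃ Δ : Finset ((Fin (3 * a + 3 * b) → Fin 3) × (Fin (3 * a + 3 * b) → Fin 3) ×
        (Fin (3 * a + 3 * b) → Fin 3)),
      (∀ δ ∈ Δ, ∀ t, (δ.1 t : ℕ) + δ.2.1 t + δ.2.2 t = 2) ∧
      (∀ δ ∈ Δ, (univ.filter fun t => δ.1 t = 1 ∧ δ.2.1 t = 1).card = a ∧
        (univ.filter fun t => δ.1 t = 0 ∧ δ.2.1 t = 1).card = a ∧
        (univ.filter fun t => δ.1 t = 1 ∧ δ.2.1 t = 0).card = a) ∧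
      (∀ δ ∈ Δ, ∀ δ' ∈ Δ, ∀ δ'' ∈ Δ,
        (∀ t, (δ.1 t : ℕ) + δ'.2.1 t + δ''.2.2 t = 2) → δ = δ' ∧ δ' = δ'') ∧
      Nat.multinomial univ ![a + 2 * b, 2 * a, b] *
          rothNumberNat (3 * ((2 * a).choose a * ((a + 2 * b).choose a * (2 * b).choose b))) ≤
        288 * ((2 * a).choose a * ((a + 2 * b).choose a * (2 * b).choose b)) * Δ.card := by
  classical
  set N := 3 * a + 3 * b with hN
  -- the type-restricted support, made opaque
  obtain ⟨Φ, hΦ⟩ : ∃ Φ : Finset ((Fin N → Fin 3) × (Fin N → Fin 3) × (Fin N → Fin 3)),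
      Φ = univ.filter fun φ =>
        (∀ t, (φ.1 t : ℕ) + φ.2.1 t + φ.2.2 t = 2) ∧
        (letterCount φ.1 0 = a + 2 * b ∧ letterCount φ.1 1 = 2 * a ∧ letterCount φ.1 2 = b) ∧
        (letterCount φ.2.1 0 = a + 2 * b ∧ letterCount φ.2.1 1 = 2 * a ∧ letterCount φ.2.1 2 = b) ∧
        (letterCount φ.2.2 0 = a + 2 * b ∧ letterCount φ.2.2 1 = 2 * a ∧ letterCount φ.2.2 2 = b) :=
    ⟨_, rfl⟩
  have hmem : ∀ φ, φ ∈ Φ ↔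
      (∀ t, (φ.1 t : ℕ) + φ.2.1 t + φ.2.2 t = 2) ∧
        (letterCount φ.1 0 = a + 2 * b ∧ letterCount φ.1 1 = 2 * a ∧ letterCount φ.1 2 = b) ∧
        (letterCount φ.2.1 0 = a + 2 * b ∧ letterCount φ.2.1 1 = 2 * a ∧ letterCount φ.2.1 2 = b) ∧
        (letterCount φ.2.2 0 = a + 2 * b ∧ letterCount φ.2.2 1 = 2 * a ∧ letterCount φ.2.2 2 = b) := by
    intro φ; rw [hΦ, mem_filter]; simp only [mem_univ, true_and]
  -- pattern counts on `Φ`, in the three cyclic coordinate systems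
  have hpatI : ∀ φ ∈ Φ, levelPairCount φ.1 φ.2.1 1 1 = a ∧ levelPairCount φ.1 φ.2.1 0 1 = a ∧
      levelPairCount φ.1 φ.2.1 1 0 = a ∧ levelPairCount φ.1 φ.2.1 0 0 = b := by
    intro φ hφ
    obtain ⟨hs, ⟨h10, h11, -⟩, ⟨h20, h21, h22⟩, ⟨-, -, h32⟩⟩ := (hmem φ).1 hφ
    obtain ⟨e1, e2, e3, e4, -⟩ := laserPatternCounts φ.1 φ.2.1 φ.2.2 hs h10 h11 h20 h21 h22 h32
    exact ⟨e1, e2, e3, e4⟩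
  have hpatJ : ∀ φ ∈ Φ, levelPairCount φ.2.1 φ.2.2 1 1 = a ∧ levelPairCount φ.2.1 φ.2.2 0 1 = a ∧
      levelPairCount φ.2.1 φ.2.2 0 0 = b := by
    intro φ hφ
    obtain ⟨hs, ⟨-, -, h12⟩, ⟨h20, h21, -⟩, ⟨h30, h31, h32⟩⟩ := (hmem φ).1 hφ
    obtain ⟨e1, e2, -, e4, -⟩ := laserPatternCounts φ.2.1 φ.2.2 φ.1
      (fun t => by have := hs t; omega) h20 h21 h30 h31 h32 h12
    exact ⟨e1, e2, e4⟩
  have hpatL : ∀ φ ∈ Φ, levelPairCount φ.2.2 φ.1 1 1 = a ∧ levelPairCount φ.2.2 φ.1 0 1 = a ∧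
      levelPairCount φ.2.2 φ.1 0 0 = b := by
    intro φ hφ
    obtain ⟨hs, ⟨h10, h11, h12⟩, ⟨-, -, h22⟩, ⟨h30, h31, -⟩⟩ := (hmem φ).1 hφ
    obtain ⟨e1, e2, -, e4, -⟩ := laserPatternCounts φ.2.2 φ.1 φ.2.1
      (fun t => by have := hs t; omega) h30 h31 h10 h11 h12 h22
    exact ⟨e1, e2, e4⟩
  -- the fibre bound `f`, made opaque
  obtain ⟨f, hf⟩ : ∃ f : ℕ, f = (2 * a).choose a * ((a + 2 * b).choose a * (2 * b).choose b) :=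
    ⟨_, rfl⟩
  have hf1 : 1 ≤ f := by
    rw [hf]
    exact Nat.mul_pos (Nat.choose_pos (by omega))
      (Nat.mul_pos (Nat.choose_pos (by omega)) (Nat.choose_pos (by omega)))
  have hfval : ∀ P₀ : Fin N → Fin 3, letterCount P₀ 0 = a + 2 * b → letterCount P₀ 1 = 2 * a →
      (letterCount P₀ 1).choose a * ((letterCount P₀ 0).choose a * (letterCount P₀ 0 - a).choose b) = f := by
    intro P₀ h0 h1
    rw [h0, h1, hf, show a + 2 * b - a = 2 * b by omega]
  -- fibres over the first coordinate
  have hfI : ∀ I₀, (Φ.filter fun φ => φ.1 = I₀).card ≤ f := by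
    intro I₀
    rcases (Φ.filter fun φ => φ.1 = I₀).eq_empty_or_nonempty with he | ⟨φ₀, hφ₀⟩
    · rw [he, card_empty]; exact Nat.zero_le _
    obtain ⟨hφ₀Φ, hφ₀I⟩ := mem_filter.1 hφ₀
    obtain ⟨-, ⟨hI0, hI1, -⟩, -⟩ := (hmem φ₀).1 hφ₀Φ
    rw [hφ₀I] at hI0 hI1
    rw [← hfval I₀ hI0 hI1, ← card_image_of_injOn (f := fun φ => φ.2) (fun φ hφ φ' hφ' h => by
      have e1 := (mem_filter.1 (mem_coe.1 hφ)).2; have e2 := (mem_filter.1 (mem_coe.1 hφ')).2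
      exact Prod.ext (e1.trans e2.symm) h)]
    refine card_filter_fibre_le I₀ a b _ fun s hs => ?_
    obtain ⟨φ, hφ, rfl⟩ := mem_image.1 hs
    obtain ⟨hφΦ, hφI⟩ := mem_filter.1 hφ
    subst hφI
    obtain ⟨e1, e2, -, e4⟩ := hpatI φ hφΦ
    exact ⟨((hmem φ).1 hφΦ).1, e1, e2, e4⟩
  -- fibres over the second coordinate (coordinates `(J, L, I)`)
  have hfJ : ∀ J₀, (Φ.filter fun φ => φ.2.1 = J₀).card ≤ f := by
    intro J₀
    rcases (Φ.filter fun φ => φ.2.1 = J₀).eq_empty_or_nonempty with he | ⟨φ₀, hφ₀⟩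
    · rw [he, card_empty]; exact Nat.zero_le _
    obtain ⟨hφ₀Φ, hφ₀J⟩ := mem_filter.1 hφ₀
    obtain ⟨-, -, ⟨hJ0, hJ1, -⟩, -⟩ := (hmem φ₀).1 hφ₀Φ
    rw [hφ₀J] at hJ0 hJ1
    rw [← hfval J₀ hJ0 hJ1, ← card_image_of_injOn (f := fun φ => (φ.2.2, φ.1))
      (fun φ hφ φ' hφ' h => by
        have e1 := (mem_filter.1 (mem_coe.1 hφ)).2; have e2 := (mem_filter.1 (mem_coe.1 hφ')).2
        simp only [Prod.mk.injEq] at h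
        exact Prod.ext h.2 (Prod.ext (e1.trans e2.symm) h.1))]
    refine card_filter_fibre_le J₀ a b _ fun s hs => ?_
    obtain ⟨φ, hφ, rfl⟩ := mem_image.1 hs
    obtain ⟨hφΦ, hφJ⟩ := mem_filter.1 hφ
    subst hφJ
    obtain ⟨e1, e2, e4⟩ := hpatJ φ hφΦ
    exact ⟨fun t => by have := ((hmem φ).1 hφΦ).1 t; simp only; omega, e1, e2, e4⟩
  -- fibres over the third coordinate (coordinates `(L, I, J)`)
  have hfL : ∀ L₀, (Φ.filter fun φ => φ.2.2 = L₀).card ≤ f := by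
    intro L₀
    rcases (Φ.filter fun φ => φ.2.2 = L₀).eq_empty_or_nonempty with he | ⟨φ₀, hφ₀⟩
    · rw [he, card_empty]; exact Nat.zero_le _
    obtain ⟨hφ₀Φ, hφ₀L⟩ := mem_filter.1 hφ₀
    obtain ⟨-, -, -, ⟨hL0, hL1, -⟩⟩ := (hmem φ₀).1 hφ₀Φ
    rw [hφ₀L] at hL0 hL1
    rw [← hfval L₀ hL0 hL1, ← card_image_of_injOn (f := fun φ => (φ.1, φ.2.1))
      (fun φ hφ φ' hφ' h => by
        have e1 := (mem_filter.1 (mem_coe.1 hφ)).2; have e2 := (mem_filter.1 (mem_coe.1 hφ')).2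
        simp only [Prod.mk.injEq] at h
        exact Prod.ext h.1 (Prod.ext h.2 (e1.trans e2.symm)))]
    refine card_filter_fibre_le L₀ a b _ fun s hs => ?_
    obtain ⟨φ, hφ, rfl⟩ := mem_image.1 hs
    obtain ⟨hφΦ, hφL⟩ := mem_filter.1 hφ
    subst hφL
    obtain ⟨e1, e2, e4⟩ := hpatL φ hφΦ
    exact ⟨fun t => by have := ((hmem φ).1 hφΦ).1 t; simp only; omega, e1, e2, e4⟩
  -- tightness maps
  let ind : (Fin N → Fin 3) → Fin N → ℤ := fun P t => ((P t : ℕ) : ℤ)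
  let ind' : (Fin N → Fin 3) → Fin N → ℤ := fun P t => ((P t : ℕ) : ℤ) - 2
  have hind_inj : Function.Injective ind := by
    intro P P' h; funext t; have := congrFun h t; simp only [ind, Nat.cast_inj] at this
    exact Fin.ext this
  have hind'_inj : Function.Injective ind' := by
    intro P P' h; funext t; have := congrFun h t; simp only [ind', sub_left_inj, Nat.cast_inj] at this
    exact Fin.ext this
  have hind_bd : ∀ P t, |ind P t| ≤ 2 := by
    intro P t
    have := (P t).2
    simp only [ind]
    rw [abs_of_nonneg (by positivity)]
    exact_mod_cast (by omega : (P t : ℕ) ≤ 2)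
  have htight : ∀ φ ∈ Φ, ∀ t, ind φ.1 t + ind φ.2.1 t + ind' φ.2.2 t = 0 := by
    intro φ hφ t
    have := ((hmem φ).1 hφ).1 t
    simp only [ind, ind']
    omega
  -- a Bertrand prime `6f < M ≤ 12f`
  obtain ⟨M, hMp, hM1, hM2⟩ := Nat.exists_prime_lt_and_le_two_mul (6 * f) (by omega)
  haveI : NeZero M := ⟨hMp.ne_zero⟩
  have hM4 : 2 * 2 < M := by omega
  have hM3 : 2 * (M / 2) ≤ M := Nat.mul_div_le M 2
  have hfM : 3 * f ≤ M / 2 := by omega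
  have hM12 : M ≤ 12 * f := by omega
  -- the Salem–Spencer diagonal with `k = M / 2`
  obtain ⟨D₁, D₂, D₃, hD₁, hD₂, hD₃, hDcard⟩ := exists_zeroSum_diagonal M (M / 2) hM3
  -- the hashing theorem
  obtain ⟨Δ, hΔΦ, hfree, hsize⟩ := BCS1997_thm1539_free Φ (r := N) (b := 2) ind ind ind' hind_inj
    hind_inj hind'_inj hind_bd hind_bd htight hfI hfJ hfL hMp hM4 D₁ D₂ D₃ hD₁ hD₂ hD₃
  refine ⟨Δ, fun δ hδ => ((hmem δ).1 (hΔΦ hδ)).1, fun δ hδ => ?_, ?_, ?_⟩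
  · obtain ⟨e1, e2, e3, -⟩ := hpatI δ (hΔΦ hδ)
    exact ⟨e1, e2, e3⟩
  · -- freeness in pointwise form
    intro δ hδ δ' hδ' δ'' hδ'' hs
    refine hfree δ hδ δ' hδ' δ'' hδ'' ((hmem _).2 ⟨hs, ?_, ?_, ?_⟩)
    · exact ((hmem δ).1 (hΔΦ hδ)).2.1
    · exact ((hmem δ').1 (hΔΦ hδ')).2.2.1
    · exact ((hmem δ'').1 (hΔΦ hδ'')).2.2.2
  · -- the size bound, from `|Φ| |D| (M - 3f) ≤ M³ |Δ|` with `6f < M ≤ 12 f` and `|Φ| ≥ binom · f`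
    have hΦcard : Nat.multinomial univ ![a + 2 * b, 2 * a, b] * f ≤ Φ.card := by
      rw [hf, ← multinomial_six_eq]
      exact le_card_laserSupport a b hN Φ fun φ h1 h2 h3 h4 => (hmem φ).2 ⟨h1, h2, h3, h4⟩
    obtain ⟨D, hD⟩ : ∃ D : Finset (ZMod M × ZMod M × ZMod M),
        D = (D₁ ×ˢ D₂ ×ˢ D₃).filter fun d => d.1 + d.2.1 + d.2.2 = 0 := ⟨_, rfl⟩
    rw [← hD] at hsize hDcard
    have hroth : rothNumberNat (3 * f) ≤ D.card := (rothNumberNat.mono hfM).trans hDcard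
    have hM0 : (0 : ℤ) < M := by exact_mod_cast hMp.pos
    have hf0 : (0 : ℤ) < f := by exact_mod_cast hf1
    have hΦD : (0 : ℤ) ≤ (Φ.card : ℤ) * D.card := mul_nonneg (Nat.cast_nonneg _) (Nat.cast_nonneg _)
    have hM6 : (6 * f : ℤ) < M := by exact_mod_cast hM1
    set C := Nat.multinomial univ ![a + 2 * b, 2 * a, b] with hC
    have h1 : (Φ.card : ℤ) * D.card * M ≤ 2 * (M : ℤ) ^ 3 * Δ.card :=
      calc (Φ.card : ℤ) * D.card * M ≤ (Φ.card : ℤ) * D.card * (2 * ((M : ℤ) - 3 * f)) :=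
            mul_le_mul_of_nonneg_left (by linarith only [hM6]) hΦD
        _ = 2 * ((Φ.card : ℤ) * D.card * ((M : ℤ) - 3 * f)) := by ring
        _ ≤ 2 * ((M : ℤ) ^ 3 * Δ.card) := mul_le_mul_of_nonneg_left hsize (by norm_num)
        _ = 2 * (M : ℤ) ^ 3 * Δ.card := by ring
    have h2 : (Φ.card : ℤ) * D.card ≤ 2 * (M : ℤ) ^ 2 * Δ.card := by
      refine le_of_mul_le_mul_right ?_ hM0
      calc (Φ.card : ℤ) * D.card * M ≤ 2 * (M : ℤ) ^ 3 * Δ.card := h1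
        _ = 2 * (M : ℤ) ^ 2 * Δ.card * M := by ring
    have hMsq : (M : ℤ) ^ 2 ≤ (12 * f : ℤ) ^ 2 :=
      pow_le_pow_left₀ hM0.le (by exact_mod_cast hM12) 2
    have h3 : (C : ℤ) * f * rothNumberNat (3 * f) ≤ 2 * (12 * (f : ℤ)) ^ 2 * Δ.card :=
      calc (C : ℤ) * f * rothNumberNat (3 * f) ≤ (Φ.card : ℤ) * D.card := by
            have := Nat.mul_le_mul hΦcard hroth
            exact_mod_cast this
        _ ≤ 2 * (M : ℤ) ^ 2 * Δ.card := h2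
        _ ≤ 2 * (12 * (f : ℤ)) ^ 2 * Δ.card :=
            mul_le_mul_of_nonneg_right (mul_le_mul_of_nonneg_left hMsq (by norm_num))
              (Nat.cast_nonneg _)
    have h4 : (C : ℤ) * rothNumberNat (3 * f) ≤ 288 * (f : ℤ) * Δ.card := by
      refine le_of_mul_le_mul_right ?_ hf0
      calc (C : ℤ) * rothNumberNat (3 * f) * f = (C : ℤ) * f * rothNumberNat (3 * f) := by ring
        _ ≤ 2 * (12 * (f : ℤ)) ^ 2 * Δ.card := h3
        _ = 288 * (f : ℤ) * Δ.card * f := by ring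
    rw [← hf]
    exact_mod_cast h4

end Hashing

/-! ## The Kronecker power restricts to many independent matrix products -/

section Tensor

/-- **`CW_q^{⊗(3a+3b)} ≥ ⟨p⟩ ⊗ ⟨q^a, q^a, q^a⟩` with
`binom(3a+3b; a+2b, 2a, b) · rothNumberNat(3f) ≤ 288 f p`, `f = C(2a,a) C(a+2b,a) C(2b,b)`**
(BCS p. 381: `⊕_Δ t^{⊗N}(x,y,z) ≤ t^{⊗N}`, `|Δ| ≥ C min binom(N, μ)`, each component a matrix
tensor; here for the second application, `t = CW_q` with the `S₃`-invariant distribution of p. 384,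
as a genuine restriction along the free diagonal of `exists_free_bigCw_diagonal` and
`bigCw_kroneckerPow_blocks`). [cite: BurgisserClausenShokrollahi1997, Thm. 15.41 (proof, p. 381) and p. 384] -/
theorem exists_restrictsTo_bigCw_kroneckerPow (K : Type u) [CommSemiring K] (q a b : ℕ) :
    ∃ p : ℕ, Nat.multinomial univ ![a + 2 * b, 2 * a, b] *
        rothNumberNat (3 * ((2 * a).choose a * ((a + 2 * b).choose a * (2 * b).choose b))) ≤
        288 * ((2 * a).choose a * ((a + 2 * b).choose a * (2 * b).choose b)) * p ∧
      TensorRestrictsTo (kroneckerPow (bigCwTensor K q) (3 * a + 3 * b))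
        (kroneckerTensor (unitTensor K p) (matMulTensor K (q ^ a) (q ^ a) (q ^ a))) := by
  classical
  obtain ⟨Δ, hsupp, hcard, hfree, hsize⟩ := exists_free_bigCw_diagonal a b
  obtain ⟨F, G, H, hFGH⟩ := bigCw_kroneckerPow_blocks K q a (3 * a + 3 * b) Δ hsupp hcard hfree
  refine ⟨Δ.card, hsize, ?_⟩
  rw [hFGH]
  exact tensorRestrictsTo_precomp _ F G H

end Tensor

end Literature.Computability.AlgebraicComplexity

end
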